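import Literature.Computability.AlgebraicComplexity.MS2001StableObstructionMultiplicity
import Literature.Computability.AlgebraicComplexity.BI17DetPerMinimalDegreeProofs
import Literature.Computability.AlgebraicComplexity.SLOrbitOpenInClosure
import Literature.Computability.AlgebraicComplexity.BI17QuadraticPolystableProofs
import Literature.Computability.AlgebraicComplexity.PolynomialKoszulYoungFlatteningMonotone
import HarnessLib

/-!
# GCT I, Thm. 5.1, MULTIPLICITY form over `ℂ` — II: cone reduction, assembly, all finite variable
# types (Mulmuley–Sohoni 2001, Thm. 5.1: «More generally, `W` is an obstruction for `(f, g)` if the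
# multiplicity of the trivial `H`-representation within `W` exceeds that of the trivial
# `Q`-representation»)

Sequel (THEOREMS ONLY: no definition, no named fact; D-0026) of
`MS2001StableObstructionMultiplicity.lean`, which proves `dim (Sym^r)^{SL ∩ G_f} ≤ dim (Sym^r)^{SL ∩ G_g}`
for a polystable form `f` in the Zariski closure of the `SL`-orbit of `g`. The typed fact
`MS2001_thm_5_1` (`MS2001ClassVarieties.lean`) concludes `f ∉ Δ[g] = \overline{GL·g}` (affine-cone
rendering of «`f` cannot lie in the closure of the `G`-orbit of `g` in the projective space `P(V)`»,
AV p. 20 L1369–1371; MS: «`f` lies in the closure of the `G`-orbit of `g` in `P(V)` iff it lies,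
considered as a point in `V`, [in] the closure of the `GL(Y)`-orbit of `g` in `V`», AV p. 19 L2–3).
This file supplies the passage from `GL` to `SL` and the final statement:

* § 1 **Cone reduction** `exists_smul_mem_zariskiClosure_slOrbit_of_mem_orbitClosure` (`Fin n`
  variables): a polystable form `f ≠ 0` of degree `D` lying in `Δ[g]` has a non-zero scalar
  multiple `c • f` in the Zariski closure of `SL·g`. This is the scalar bookkeeping of MS's Luna
  proof («`U` must contain a point `p` whose some multiple `p'` lies in the `G`-orbit of `g`», AV
  p. 20 L1382–1384) done in the Euclidean topology exactly as in Bürgisser–Ikenmeyer 2017, proof of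
  Prop. 3.9 (1) (the tree's `IsSLInvariantCoord.aeval_formCoeff_eq_zero_of_not_mem_glOrbit`): write
  `g_n = s_n h_n`, `h_n ∈ SL`, with `g_n·g → f` (Zariski = Euclidean closure,
  `orbitClosure_eq_euclidean_closure_complex_holds`); a homogeneous `SL`-invariant `Φ` with
  `Φ(f) ≠ 0` (Hilbert–Mumford nonvanishing for the closed orbit,
  `exists_isSLInvariantCoord_aeval_formCoeff_ne_zero`) forces `(s_n^D)` to be bounded and bounded
  away from `0`; a convergent subsequence `s_n^D → δ ≠ 0` gives `h_n·g → δ⁻¹ f`.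
* § 2 elementary cases: scalars do not change stabilisers (`fixedForms_smul`), the zero form, forms
  of degree `0`, no variables.
* § 3 `MS2001_thm_5_1_complex_fin`: the multiplicity criterion over `ℂ` in `Fin n` variables.
* § 4 transport along a renaming `σ ≃ τ` of the variables (`fixedForms` and its dimension;
  `IsPolystable` and `orbitClosure` are the tree's `IsPolystable.rename_equiv`,
  `rename_equiv_mem_orbitClosure`) and **`MS2001_thm_5_1_complex`**: the typed fact
  `MS2001_thm_5_1` AT `F = ℂ`, literally — every finite variable type `σ`, `W = Sym^r`,
  `∃ r, dim (Sym^r)^{Q} < dim (Sym^r)^{H} ⇒ f ∉ Δ[g]` for `f` polystable.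

Honest framing: GCT I Thm. 5.1 (multiplicity form, `W = Sym^r`) is now a theorem of the tree OVER
`ℂ`, slice-free; the named fact `MS2001_thm_5_1` quantifies over ALL algebraically closed fields of
characteristic `0` and is NOT discharged (the route uses Kempf–Ness and the Euclidean topology).
Nothing here bears on VP versus VNP.

## References

* [MulmuleySohoniSIAM2001] K. D. Mulmuley, M. Sohoni, *Geometric complexity theory I*, SIAM J.
  Comput. 31 (2001) 496–526; authors' version (2001-04-23), §5 p. 19 L1–3 (projective vs. affine
  closure), Thm. 5.1 and proof, p. 20 (all.txt L1365–1390).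
* [BurgisserIkenmeyer2017] P. Bürgisser, C. Ikenmeyer, *Fundamental invariants of orbit closures*,
  J. Algebra 477 (2017), proof of Prop. 3.9 (1) (the sequence argument `g_n = t_n g̃_n`).
* [MumfordFogartyKirwan1994] D. Mumford, J. Fogarty, F. Kirwan, *Geometric Invariant Theory*, Ch. 2
  §1 Prop. 2.2 (a closed orbit off `0` carries a non-vanishing invariant) — through
  `BI17DegreeExponentMonoidProofs.lean`.

## Provenance

Cell `val-lit`, seat `val-lit-t02` generation 8 (row MS2001-A / MS2008 lineage).
-/

noncomputable section

open MvPolynomial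
open scoped Matrix
open _root_.Filter _root_.Topology

namespace Literature.Computability.AlgebraicComplexity

/-! ### § 1 Cone reduction: a polystable point of `Δ[g]` is an `SL`-degeneration of a multiple of `g` -/

section Cone

variable {n D : ℕ}

/-- The zero locus of an ideal of polynomial functions is closed in the classical topology of `ℂ^ι`.
[folklore] -/
private theorem isClosed_zeroLocus₂ {ι : Type*} (I : Ideal (MvPolynomial ι ℂ)) :
    IsClosed (MvPolynomial.zeroLocus ℂ I) := by
  have h : MvPolynomial.zeroLocus ℂ I = ⋂ p : I, {x : ι → ℂ | aeval x (p : MvPolynomial ι ℂ) = 0} := by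
    ext x
    rw [MvPolynomial.mem_zeroLocus_iff, Set.mem_iInter]
    exact ⟨fun h p => h p p.2, fun h p hp => h ⟨p, hp⟩⟩
  rw [h]
  exact isClosed_iInter fun p =>
    isClosed_eq (Literature.NumberTheory.Transcendental.AlgHomClosure.continuous_aeval _) continuous_const

/-- Values of a homogeneous polynomial at a rescaled point: `F(c • x) = c ^ d * F(x)`. [folklore] -/
private theorem aeval_smul_pt_of_isHomogeneous₂ {ι : Type*} {F : MvPolynomial ι ℂ} {d : ℕ}
    (hF : F.IsHomogeneous d) (c : ℂ) (x : ι → ℂ) : aeval (c • x) F = c ^ d * aeval x F := by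
  classical
  rw [F.as_sum, map_sum, map_sum, Finset.mul_sum]
  refine Finset.sum_congr rfl fun s hs => ?_
  simp only [aeval_monomial, Pi.smul_apply, smul_eq_mul, mul_pow, Finsupp.prod,
    Finset.prod_mul_distrib]
  rw [Finset.prod_pow_eq_pow_sum, ← hF.degree_eq_sum_deg_support hs]
  ring

/-- **Cone reduction** (the scalar step of GCT I Thm. 5.1's proof, AV p. 20 L1382–1384: «`U` must
contain a point `p` whose some multiple `p'` lies in the `G`-orbit of `g`», in the Euclidean form of
Bürgisser–Ikenmeyer's proof of Prop. 3.9 (1)): over `ℂ`, in `n ≥ 1` variables, if a polystable form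
`f ≠ 0` of degree `D` lies in the orbit closure `Δ[g] = \overline{GL·g}` of a form `g` of degree
`D`, then some non-zero multiple `c • f` lies (coefficientwise) in the Zariski closure of the
`SL`-orbit of `g`. Proof: `g_k · g → f` with `g_k = s_k h_k`, `h_k ∈ SL`; an `SL`-invariant `Φ`,
homogeneous of degree `e ≥ 1` with `Φ(f) ≠ 0`, gives `(s_k^D)^e Φ(g) → Φ(f) ≠ 0`, so `(s_k^D)` is
bounded with a limit point `δ ≠ 0`, and `h_k · g → δ⁻¹ f` along the subsequence.
[cite: MulmuleySohoniSIAM2001, Thm. 5.1, proof (AV p.20, all.txt L1374–1390)]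
[cite: BurgisserIkenmeyer2017, Prop. 3.9 (1) (proof)] -/
theorem exists_smul_mem_zariskiClosure_slOrbit_of_mem_orbitClosure (hn : 0 < n)
    {f g : MvPolynomial (Fin n) ℂ} (hf : f.IsHomogeneous D) (hg : g.IsHomogeneous D) (hf0 : f ≠ 0)
    (hst : IsPolystable f) (hmem : f ∈ orbitClosure g) :
    ∃ c : ℂ, c ≠ 0 ∧ coeffVec (c • f) ∈ zariskiClosure (coeffVec '' slOrbit (Fin n) ℂ g) := by
  classical
  -- (1) a sequence `A k ∈ GL_n` with `A k · g → f` coefficientwise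
  have hfc : (fun d : {d : Fin n →₀ ℕ // d.degree = D} => coeffVec f d.1) ∈
      closure ((fun q (d : {d : Fin n →₀ ℕ // d.degree = D}) => coeffVec q d.1) ''
        glOrbit (Fin n) ℂ g) := by
    rw [← orbitClosure_eq_euclidean_closure_complex_holds (σ := Fin n) hg]
    exact ⟨f, hmem, rfl⟩
  haveI : Fintype {d : Fin n →₀ ℕ // d.degree = D} :=
    Fintype.subtype ((Finset.univ : Finset (Fin n)).finsuppAntidiag D) fun d => by
      simp [Finset.mem_finsuppAntidiag, Finsupp.degree_eq_sum]
  obtain ⟨x, hxmem, hxlim⟩ := mem_closure_iff_seq_limit.1 hfc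
  choose p hp hpx using hxmem
  choose A hA using hp
  have hylim : Tendsto (fun k => formCoeff D (linSubstRep (Fin n) ℂ (A k) g)) atTop
      (𝓝 (formCoeff D f)) := by
    rw [tendsto_pi_nhds]
    intro d
    have hd : d.1.degree = D := mem_degMonomials_iff.1 d.2
    have h1 := tendsto_pi_nhds.1 hxlim ⟨d.1, hd⟩
    have h2 : (fun k => x k ⟨d.1, hd⟩) = fun k => formCoeff D (linSubstRep (Fin n) ℂ (A k) g) d := by
      funext k
      rw [← hpx k, ← hA k]
      rfl
    rwa [h2] at h1
  -- (2) `A k = s k · h k`, `h k ∈ SL_n`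
  choose s hs0 h hdec using fun k => exists_eq_scalar_mul_toGL hn (A k)
  have hy : ∀ k, formCoeff D (linSubstRep (Fin n) ℂ (A k) g) =
      s k ^ D • formCoeff D (linSubst (Fin n) ℂ (h k : Matrix (Fin n) (Fin n) ℂ) g) := by
    intro k
    rw [hdec k, linSubstRep_scalar_mul_toGL hg (hs0 k) (h k), formCoeff_smul]
  -- (3) an `SL`-invariant `Φ`, homogeneous of degree `e ≥ 1`, with `Φ(f) ≠ 0`; `Φ(g) ≠ 0`
  obtain ⟨Φ, e, he, hΦh, hΦi, hΦf⟩ := exists_isSLInvariantCoord_aeval_formCoeff_ne_zero hn hf hf0 hst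
  have hΦval : ∀ k, aeval (formCoeff D (linSubstRep (Fin n) ℂ (A k) g)) Φ =
      (s k ^ D) ^ e * aeval (formCoeff D g) Φ := by
    intro k
    rw [hy k, aeval_smul_pt_of_isHomogeneous₂ hΦh, hΦi.aeval_formCoeff_linSubst (h k) g]
  have hΦlim : Tendsto (fun k => (s k ^ D) ^ e * aeval (formCoeff D g) Φ) atTop
      (𝓝 (aeval (formCoeff D f) Φ)) := by
    have h1 := ((Literature.NumberTheory.Transcendental.AlgHomClosure.continuous_aeval Φ).tendsto
      _).comp hylim
    have h2 : (fun w : DegIdx (Fin n) D → ℂ => aeval w Φ) ∘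
        (fun k => formCoeff D (linSubstRep (Fin n) ℂ (A k) g)) =
        fun k => (s k ^ D) ^ e * aeval (formCoeff D g) Φ := by
      funext k
      exact hΦval k
    rwa [h2] at h1
  have hΦg : aeval (formCoeff D g) Φ ≠ 0 := by
    intro h0
    simp_rw [h0, mul_zero] at hΦlim
    exact hΦf (tendsto_nhds_unique hΦlim tendsto_const_nhds)
  -- (4) `t k := s k ^ D` is bounded: `(t k) ^ e → Φ(f) / Φ(g)`
  have htlim : Tendsto (fun k => (s k ^ D) ^ e) atTop
      (𝓝 (aeval (formCoeff D f) Φ * (aeval (formCoeff D g) Φ)⁻¹)) := by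
    have h1 := hΦlim.mul_const ((aeval (formCoeff D g) Φ)⁻¹)
    have h2 : (fun k => (s k ^ D) ^ e * aeval (formCoeff D g) Φ * (aeval (formCoeff D g) Φ)⁻¹) =
        fun k => (s k ^ D) ^ e := by
      funext k
      rw [mul_assoc, mul_inv_cancel₀ hΦg, mul_one]
    rwa [h2] at h1
  obtain ⟨M, hM⟩ := (Metric.isBounded_range_of_tendsto _ htlim).exists_norm_le
  have htb : ∀ k, ‖s k ^ D‖ ≤ max M 1 := by
    intro k
    by_cases hle : ‖s k ^ D‖ ≤ 1
    · exact hle.trans (le_max_right _ _)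
    · rw [not_le] at hle
      have h1 : ‖s k ^ D‖ ≤ ‖s k ^ D‖ ^ e := le_self_pow₀ hle.le he.ne'
      rw [← norm_pow] at h1
      exact (h1.trans (hM _ ⟨k, rfl⟩)).trans (le_max_left _ _)
  -- (5) Bolzano–Weierstrass: `t (φ k) → δ`, and `δ ≠ 0`
  obtain ⟨δ, -, φ, hφ, hδ⟩ := tendsto_subseq_of_bounded (Metric.isBounded_closedBall (x := (0 : ℂ))
    (r := max M 1)) (x := fun k => s k ^ D) fun k => by
      rw [Metric.mem_closedBall, dist_zero_right]; exact htb k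
  have hδ0 : δ ≠ 0 := by
    intro hδ0
    have h1 : Tendsto (fun k => (s (φ k) ^ D) ^ e) atTop (𝓝 (δ ^ e)) := hδ.pow e
    have h2 := htlim.comp hφ.tendsto_atTop
    have h3 := tendsto_nhds_unique h1 h2
    rw [hδ0, zero_pow he.ne'] at h3
    exact mul_ne_zero hΦf (inv_ne_zero hΦg) h3.symm
  -- (6) `h (φ k) · g → δ⁻¹ • f`, a point of the closed set `Z(I(SL·g))`
  have hylim' := hylim.comp hφ.tendsto_atTop
  have hzlim : Tendsto (fun k => formCoeff D (linSubst (Fin n) ℂ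
      (h (φ k) : Matrix (Fin n) (Fin n) ℂ) g)) atTop (𝓝 (δ⁻¹ • formCoeff D f)) := by
    have heq : (fun k => formCoeff D (linSubst (Fin n) ℂ (h (φ k) : Matrix (Fin n) (Fin n) ℂ) g)) =
        fun k => (s (φ k) ^ D)⁻¹ • formCoeff D (linSubstRep (Fin n) ℂ (A (φ k)) g) := by
      funext k
      rw [hy (φ k), smul_smul, inv_mul_cancel₀ (pow_ne_zero _ (hs0 _)), one_smul]
    rw [heq]
    exact (hδ.inv₀ hδ0).smul hylim'
  set Z : Set (DegIdx (Fin n) D → ℂ) := MvPolynomial.zeroLocus ℂ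
    (MvPolynomial.vanishingIdeal ℂ (formCoeff D '' slOrbit (Fin n) ℂ g)) with hZ
  have hZcl : IsClosed Z := isClosed_zeroLocus₂ _
  have hmemZ : δ⁻¹ • formCoeff D f ∈ Z :=
    hZcl.mem_of_tendsto hzlim (Eventually.of_forall fun k =>
      MvPolynomial.zeroLocus_vanishingIdeal_le _ ⟨_, ⟨h (φ k), rfl⟩, rfl⟩)
  -- (7) back to the all-monomial coordinates
  refine ⟨δ⁻¹, inv_ne_zero hδ0, ?_⟩
  refine coeffVec_mem_zariskiClosure_of_formCoeff_mem_zeroLocus (m := D)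
    (fun P hP => isHomogeneous_of_mem_slOrbit hg P hP)
    ((mem_homogeneousSubmodule D _).mp ((homogeneousSubmodule (Fin n) ℂ D).smul_mem δ⁻¹
      ((mem_homogeneousSubmodule D f).mpr hf))) ?_
  rw [formCoeff_smul]
  exact hmemZ

end Cone

/-! ### § 2 Elementary cases: scalars, the zero form, degree `0` -/

section Elementary

variable {k : Type*} [Field k] {σ : Type*} [Fintype σ] [DecidableEq σ]

/-- **Scalars do not change the fixed forms**: `(Sym^r)^{G ∩ G_{c f}} = (Sym^r)^{G ∩ G_f}` for
`c ≠ 0` (the action is linear, so `G_{cf} = G_f`).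
[cite: MulmuleySohoniGCT2SIAM2008, §1 (the set `V^{G_v̂}` of points stabilized by `G_v̂`)] -/
theorem fixedForms_smul {c : k} (hc : c ≠ 0) (G : Subgroup (GL σ k)) (f : MvPolynomial σ k)
    (r : ℕ) : fixedForms G (c • f) r = fixedForms G f r := by
  ext p
  simp only [mem_fixedForms_iff, map_smul]
  refine ⟨fun h => ⟨h.1, fun γ hγ hγf => h.2 γ hγ (by rw [hγf])⟩,
    fun h => ⟨h.1, fun γ hγ hγf => h.2 γ hγ (smul_right_injective _ hc hγf)⟩⟩

/-- The forms fixed by all of `G` (the case `f = 0`: every `γ` stabilises `0`) are fixed by the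
stabiliser of any `g`. [cite: MulmuleySohoniGCT2SIAM2008, §1 (the set `V^{G_v̂}`)] -/
theorem fixedForms_zero_le (G : Subgroup (GL σ k)) (g : MvPolynomial σ k) (r : ℕ) :
    fixedForms G 0 r ≤ fixedForms G g r := fun _ hp =>
  mem_fixedForms_iff.mpr ⟨(mem_fixedForms_iff.mp hp).1, fun γ hγ _ =>
    (mem_fixedForms_iff.mp hp).2 γ hγ (map_zero _)⟩

/-- Forms of degree `0` are constants, fixed by every linear substitution; so their fixed forms
are the `G`-invariant forms, whatever the constant. [cite: MulmuleySohoniGCT2SIAM2008, §1 (the set `V^{G_v̂}`)] -/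
theorem fixedForms_eq_of_isHomogeneous_zero (G : Subgroup (GL σ k)) {f g : MvPolynomial σ k}
    (hf : f.IsHomogeneous 0) (hg : g.IsHomogeneous 0) (r : ℕ) :
    fixedForms G f r = fixedForms G g r := by
  have hC : ∀ {q : MvPolynomial σ k}, q.IsHomogeneous 0 → ∀ γ : GL σ k, linSubstRep σ k γ q = q := by
    intro q hq γ
    have hq0 : q = C (q.coeff 0) :=
      totalDegree_eq_zero_iff_eq_C.mp (Nat.le_zero.mp hq.totalDegree_le)
    rw [hq0, linSubstRep_apply, algHom_C, algebraMap_eq]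
  ext p
  simp only [mem_fixedForms_iff]
  exact ⟨fun h => ⟨h.1, fun γ hγ _ => h.2 γ hγ (hC hf γ)⟩,
    fun h => ⟨h.1, fun γ hγ _ => h.2 γ hγ (hC hg γ)⟩⟩

end Elementary

/-! ### § 3 The multiplicity criterion over `ℂ` in `Fin n` variables -/

/-- **GCT I, Thm. 5.1, multiplicity form, over `ℂ`, `n` ordered variables** (`W = Sym^r`,
`G = SL_n(ℂ)`, `H = SL ∩ G_f`, `Q = SL ∩ G_g`): if `f` is a polystable form of degree `D`, `g` a form
of degree `D`, and `dim (Sym^r)^Q < dim (Sym^r)^H` for some `r`, then `f ∉ Δ[g] = \overline{GL·g}`.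
Cases `f = 0` and `D = 0` are vacuous (§ 2); otherwise cone reduction (§ 1) puts a multiple `c • f`,
`c ≠ 0`, in `\overline{SL·g}`, and the `SL`-degeneration inequality of part I
(`finrank_fixedForms_le_of_orbitPullback`, with `(Sym^r)^{G_{cf}} = (Sym^r)^{G_f}`) contradicts the
hypothesis. [cite: MulmuleySohoniSIAM2001, Thm. 5.1 (AV p.20, all.txt L1365–1390; journal Thm. 5.1)] -/
theorem MS2001_thm_5_1_complex_fin {n D : ℕ} {f g : MvPolynomial (Fin n) ℂ}
    (hf : f.IsHomogeneous D) (hg : g.IsHomogeneous D) (hst : IsPolystable f)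
    (h : ∃ r : ℕ, Module.finrank ℂ (fixedForms (slSubgroup (Fin n) ℂ) g r) <
      Module.finrank ℂ (fixedForms (slSubgroup (Fin n) ℂ) f r)) :
    f ∉ orbitClosure g := by
  intro hmem
  obtain ⟨r, hr⟩ := h
  haveI : FiniteDimensional ℂ (homogeneousSubmodule (Fin n) ℂ r) :=
    finite_homogeneousSubmodule (Fin n) ℂ r
  have hTg : fixedForms (slSubgroup (Fin n) ℂ) g r ≤ homogeneousSubmodule (Fin n) ℂ r :=
    fun p hp => hp.1
  haveI : FiniteDimensional ℂ (fixedForms (slSubgroup (Fin n) ℂ) g r) :=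
    Submodule.finiteDimensional_of_le hTg
  -- `f = 0`: `(Sym^r)^{SL} ≤ (Sym^r)^{Q}`
  by_cases hf0 : f = 0
  · subst hf0
    exact hr.not_ge (Submodule.finrank_mono (fixedForms_zero_le _ g r))
  -- `D = 0`: constants, same fixed forms
  rcases Nat.eq_zero_or_pos D with hD | hD
  · subst hD
    rw [fixedForms_eq_of_isHomogeneous_zero _ hf hg] at hr
    exact lt_irrefl _ hr
  -- `0 < n`
  have hn : 0 < n := by
    rcases Nat.eq_zero_or_pos n with hn0 | hn
    · subst hn0
      exact absurd (hf.inj_right (isHomogeneous_of_isEmpty (Fin 0) ℂ f) hf0) hD.ne'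
    · exact hn
  -- cone reduction and the `SL`-degeneration inequality for `c • f`
  obtain ⟨c, hc, hz⟩ :=
    exists_smul_mem_zariskiClosure_slOrbit_of_mem_orbitClosure hn hf hg hf0 hst hmem
  have hcf : (c • f).IsHomogeneous D :=
    (mem_homogeneousSubmodule D _).mp
      ((homogeneousSubmodule (Fin n) ℂ D).smul_mem c ((mem_homogeneousSubmodule D f).mpr hf))
  have hle := finrank_fixedForms_le_of_orbitPullback hcf (hst.const_smul hc)
    (orbitPullback_eq_zero_of_mem_zariskiClosure_slOrbit hz) r
  rw [fixedForms_smul hc] at hle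
  exact hr.not_ge hle

/-! ### § 4 Renaming the variables, and the typed fact at `F = ℂ` -/

section Transport

variable {K : Type*} [Field K] {σ τ : Type*} [Fintype σ] [DecidableEq σ] [Fintype τ] [DecidableEq τ]

/-- Renaming along a bijection maps the forms fixed by `SL ∩ G_f` into the forms fixed by
`SL ∩ G_{f^e}` (conjugate the stabiliser by the permutation). [cite: MulmuleySohoniGCT2SIAM2008, §1 (the set `V^{G_v̂}`)] -/
theorem rename_mem_fixedForms_equiv (e : σ ≃ τ) {f p : MvPolynomial σ K} {r : ℕ}
    (hp : p ∈ fixedForms (slSubgroup σ K) f r) :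
    rename e p ∈ fixedForms (slSubgroup τ K) (rename e f) r := by
  obtain ⟨hpr, hpfix⟩ := mem_fixedForms_iff.mp hp
  refine mem_fixedForms_iff.mpr ⟨hpr.rename_isHomogeneous, fun γ hγ hγf => ?_⟩
  set A : Matrix σ σ K := (γ : Matrix τ τ K).submatrix e e with hA
  have hAdet : A.det = 1 := by
    rw [hA, Matrix.det_submatrix_equiv_self]
    exact mem_slSubgroup_iff.mp hγ
  have hre : ∀ q : MvPolynomial σ K,
      linSubstRep τ K γ (rename e q) = rename e (linSubst σ K A q) := by
    intro q
    rw [linSubstRep_apply, linSubst_rename_equiv]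
  have hAf : linSubst σ K A f = f := by
    apply rename_injective e e.injective
    rw [← hre, hγf]
  have hA0 : A.det ≠ 0 := by rw [hAdet]; exact one_ne_zero
  have key := hpfix (Matrix.GeneralLinearGroup.mkOfDetNeZero A hA0) (mem_slSubgroup_iff.mpr hAdet)
    (by rw [linSubstRep_apply]; exact hAf)
  rw [linSubstRep_apply] at key
  rw [hre]
  exact congrArg (rename e) key

/-- **`dim (Sym^r)^{SL ∩ G_f}` is invariant under renaming the variables along a bijection.**
[cite: MulmuleySohoniGCT2SIAM2008, §1 (the set `V^{G_v̂}`)] -/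
theorem finrank_fixedForms_rename_equiv (e : σ ≃ τ) (f : MvPolynomial σ K) (r : ℕ) :
    Module.finrank K (fixedForms (slSubgroup τ K) (rename e f) r) =
      Module.finrank K (fixedForms (slSubgroup σ K) f r) := by
  have hmap : (fixedForms (slSubgroup σ K) f r).map
      ((renameEquiv K e).toLinearEquiv : MvPolynomial σ K →ₗ[K] MvPolynomial τ K) =
      fixedForms (slSubgroup τ K) (rename e f) r := by
    apply le_antisymm
    · rintro _ ⟨p, hp, rfl⟩
      exact rename_mem_fixedForms_equiv e hp
    · intro q hq
      refine ⟨rename e.symm q, ?_, ?_⟩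
      · have h1 := rename_mem_fixedForms_equiv e.symm hq
        rwa [rename_rename, e.symm_comp_self, rename_id_apply] at h1
      · change rename e (rename e.symm q) = q
        rw [rename_rename, e.self_comp_symm, rename_id_apply]
  rw [← hmap, LinearEquiv.finrank_map_eq]

end Transport

/-- **GCT I (Mulmuley–Sohoni 2001), Thm. 5.1, MULTIPLICITY form, over `ℂ` — PROVED** for every
finite variable type: «Let `H ⊆ G` be the stabilizer of `f ∈ V`, and `Q ⊆ G` the stabilizer of
`g ∈ V`. Suppose `f` is stable with respect to the action of `G`. … More generally, `W` is an
obstruction for `(f, g)` if the multiplicity of the trivial `H`-representation within `W` exceeds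
that of the trivial `Q`-representation» (AV p. 20, all.txt L1365–1372), `G = SL_σ(ℂ)`,
`V = Sym^m ℂ^σ`, `W = Sym^r`, in the binders of the typed fact `MS2001_thm_5_1` with its field
variable set to `ℂ`: if `f` is polystable of degree `m`, `g` of degree `m`, and
`dim (Sym^r)^{SL ∩ G_g} < dim (Sym^r)^{SL ∩ G_f}` for some `r`, then `f ∉ Δ[g] = \overline{GL·g}`.
Slice-free proof: transport to `Fin n` variables (§ 4) and `MS2001_thm_5_1_complex_fin`. The named
fact itself (all algebraically closed fields of characteristic `0`) is NOT discharged by this.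
[cite: MulmuleySohoniSIAM2001, Thm. 5.1 (AV p.20, all.txt L1365–1390; journal Thm. 5.1)] -/
theorem MS2001_thm_5_1_complex (σ : Type) [Fintype σ] [DecidableEq σ] (f g : MvPolynomial σ ℂ)
    (m : ℕ) (hf : f.IsHomogeneous m) (hg : g.IsHomogeneous m) (hst : IsPolystable f)
    (h : ∃ r : ℕ, Module.finrank ℂ (fixedForms (slSubgroup σ ℂ) g r) <
      Module.finrank ℂ (fixedForms (slSubgroup σ ℂ) f r)) :
    f ∉ orbitClosure g := by
  intro hmem
  obtain ⟨r, hr⟩ := h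
  set e : σ ≃ Fin (Fintype.card σ) := Fintype.equivFin σ
  refine MS2001_thm_5_1_complex_fin (hf.rename_isHomogeneous (f := e)) (hg.rename_isHomogeneous)
    (hst.rename_equiv e) ⟨r, ?_⟩ (rename_equiv_mem_orbitClosure e hmem)
  rw [finrank_fixedForms_rename_equiv, finrank_fixedForms_rename_equiv]
  exact hr

end Literature.Computability.AlgebraicComplexity

end
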